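import Mathlib
import Summits.Ventures.PercRepro2.PMK5LocusZero
import Summits.Ventures.PercRepro2.PMK5LocusGZero
import Summits.Ventures.PercRepro2.PMK5LocusZeroI
import Summits.Ventures.PercRepro2.PMTypedPendant
import Summits.Ventures.PercRepro2.PMTypedTri

/-!
# THEOREM 19 — THE EQUALITY LOCUS OF (HCOV) ON THE SIX-VERTEX PENDANT FAMILY `K₅ + a₃ PENDANT AT u`
(blind cell PercRepro2, mine-2 g24; the lens «equality locus first» on the family of Theorems 14 / 16
(`K5.Pendant.ends6`: `K₅` on `o = 0, a₁ = 1, a₂ = 2, u = 3, b = 4` plus the pendant edge `10 = {3, 5}` to the leaf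
`a₃ = 5`), for every weight vector; on the weighted (PM) dictionary `PMPendant.Gc_pendant_quadratic` and the three
five-vertex loci — `RuleB` (Theorem 17, `PMK5Locus*`: the weighted (PM) bracket `β₁`), `RuleG` (Theorem 18,
`PMK5LocusG*`: the crux functional with `u` as the third mark) and `RuleA` (`PMK5LocusI*`: the `a₃`-inactive value))

Write `t = p 10` for the pendant weight, `q = p ∘ castSucc` for the `K₅` weights, `S ⊆ K₅` (mask `m < 1024`) for the
base edge set.  The dictionary reads (**`gc6_quadratic`**, all three coefficients in the Bernstein basis of `K₅`)
  `Gc(p) = (1 − t)² · I(q) + t (1 − t) · 2β₁(q) + t² · G(q)`,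
`I = Σ bern q · 2 CI` (the `a₃`-inactive value, `certI`), `2β₁ = Σ bern q · 2 C` (row 2′BETA1's bracket, Theorem 12),
`G = Gc q ends5 0 1 2 3 4` (the glued base, typer-1's `K₃` certificate), each `≥ 0`.  **The loci are nested
(`ruleA_of_ruleB`, `ruleG_of_ruleB`, two `decide +kernel`): `β₁ ≡ 0` on the face of `S` forces `I ≡ 0` and `G ≡ 0`
there** — the exact census: `RuleB` 536 ⊆ `RuleA` 560, `RuleB` 536 ⊆ `RuleG` 608, `RuleA ∩ RuleG = RuleB`
(1,024 / 1,024, two own codes: Kronecker class sums, and the exact centre values `Gc(½·1_S, t)` at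
`t = 0, ¼, ½, ¾, 1` through the pattern law).  Hence, on the pendant face (`S` + the pendant edge, `0 < t < 1`):
* **`gc6_zero_of_face`** — `Gc ≡ 0` on the whole face when `S` is `B`-degenerate (every `t`, every `q` on `S`);
* **`gc6_pos_of_face`** — `Gc > 0` at EVERY interior weight vector of the face when `S` is not `B`-degenerate (the
  middle term alone is positive, the other two are `≥ 0`);
* the two «iff»s **`gc6_pos_iff`** / **`gc6_zero_iff`**: (HCOV) on the six-vertex pendant family is tight exactly at
  the `B`-degenerate base placements — the root pair separates `o` from `b`; a root reaches neither `o` nor `u`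
  avoiding the other root; `o` reaches neither root — and strict everywhere else in the interior.
The two boundary faces: `t = 0` is the `a₃`-isolated locus `RuleA` (`PMK5LocusZeroI.gc_isolated_*_iff`); `t = 1` is
the glued locus `RuleG` (**`gc_glued_zero_iff`**, from Theorem 18 through `Gc_pendant_one` / `Gc_transfer`).
Standard axioms.
-/

namespace Summit.Ventures.PercRepro2

open Hub CovForm

namespace K5

namespace PM

/-! ## The inclusions of the three loci (kernel) -/

set_option maxRecDepth 100000 in
/-- **`β₁ ≡ 0` on a face forces the `a₃`-inactive value `≡ 0` there**: every `B`-degenerate edge set is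
`A`-degenerate (536 ⊆ 560). -/
theorem ruleA_of_ruleB : ∀ m : Fin 1024, RuleB m = true → RuleA m = true := by
  decide +kernel

set_option maxRecDepth 100000 in
/-- **`β₁ ≡ 0` on a face forces the glued crux functional `≡ 0` there**: every `B`-degenerate edge set is
`G`-degenerate (536 ⊆ 608; `RuleG` read with the vertex `3 = u` as the third mark). -/
theorem ruleG_of_ruleB : ∀ m : Fin 1024, RuleB m = true → RuleG m = true := by
  decide +kernel

section Pendant

variable {R : Type*} [Field R] [LinearOrder R] [IsStrictOrderedRing R]

/-- The pendant edge of `ends6` joins `a₃ = 5` to `u = 3`. -/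
lemma ends6_last' : Pendant.ends6 (Fin.last 10) = s(5, 3) := by
  rw [Pendant.ends6_last, Sym2.eq_swap]

/-- **The crux functional on the pendant family, in the `K₅` vocabulary**:
`Gc(p) = (1 − t)² · Σ bern q · 2 CI + t (1 − t) · Σ bern q · 2 C + t² · Gc q ends5 0 1 2 3 4`. -/
theorem gc6_quadratic (p : Fin 11 → R) :
    Gc p Pendant.ends6 0 1 2 5 4 =
      (1 - p (Fin.last 10)) ^ 2 *
          (∑ k' : Fin 10 → Fin 4, bern (p ∘ Fin.castSucc) k' * (2 * Pendant.CI k')) +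
        p (Fin.last 10) * (1 - p (Fin.last 10)) *
          (∑ k' : Fin 10 → Fin 4, bern (p ∘ Fin.castSucc) k' * (2 * Pendant.C k')) +
        p (Fin.last 10) ^ 2 * Gc (p ∘ Fin.castSucc) ends5 0 1 2 3 4 := by
  rw [PMPendant.Gc_pendant_quadratic (ends := Pendant.ends6) (a₃ := 5) (u := 3) (f := Fin.last 10)
    ends6_last' Pendant.leaf_five (by decide) p 0 1 2 4 (by decide) (by decide) (by decide) (by decide),
    Pendant.Gc_zero_eq_bern_I, Pendant.twoBeta1_zero_eq_bern,
    PMPendant.Gc_pendant_one (ends := Pendant.ends6) (a₃ := 5) (u := 3) (f := Fin.last 10)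
    ends6_last' Pendant.leaf_five (by decide) p 0 1 2 4 (by decide) (by decide) (by decide) (by decide),
    Pendant.Gc_transfer, Pendant.update_comp_castSucc]

/-- **THE EQUALITY LOCUS OF (HCOV) ON THE PENDANT FAMILY — THE ZERO SIDE**: on every `B`-degenerate base edge set
`m`, `Gc p ends6 0 1 2 5 4 = 0` for every weight vector `p` whose `K₅` weights are supported on `m` (the pendant
weight arbitrary). -/
theorem gc6_zero_of_face (m : ℕ) (hm : m < 1024) (hr : RuleB m = true) (p : Fin 11 → R)
    (hp₀ : ∀ e : Fin 10, m.testBit e = false → p (Fin.castSucc e) = 0) :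
    Gc p Pendant.ends6 0 1 2 5 4 = 0 := by
  rw [gc6_quadratic]
  have hI := i_K5_zero_of_face m hm (ruleA_of_ruleB ⟨m, hm⟩ hr) (p ∘ Fin.castSucc) hp₀
  have hB := beta1_K5_zero_of_face m hm hr (p ∘ Fin.castSucc) hp₀
  rw [beta1_eq_bern] at hB
  have hB' : ∑ k' : Fin 10 → Fin 4, bern (p ∘ Fin.castSucc) k' * (2 * Pendant.C k') = 0 := by
    have : ∑ k' : Fin 10 → Fin 4, bern (p ∘ Fin.castSucc) k' * (2 * Pendant.C k') =
        2 * ∑ k, bern (p ∘ Fin.castSucc) k * ((cntPosB k : ℕ) - (cntNegB k : ℕ) : R) := by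
      rw [Finset.mul_sum]
      refine Finset.sum_congr rfl fun k _ => ?_
      unfold Pendant.C
      ring
    rw [this, hB, mul_zero]
  have hG := gc_K5_zero_of_face m hm (ruleG_of_ruleB ⟨m, hm⟩ hr) (p ∘ Fin.castSucc) hp₀
  rw [hI, hB', hG]
  ring

/-- **THE EQUALITY LOCUS OF (HCOV) ON THE PENDANT FAMILY — THE POSITIVE SIDE**: on every base edge set `m` that is
not `B`-degenerate, `0 < Gc p ends6 0 1 2 5 4` at every weight vector interior on the pendant face (`0 < p_e < 1`
on the edges of `m`, `p_e = 0` off `m`, `0 < t < 1`). -/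
theorem gc6_pos_of_face (m : ℕ) (hm : m < 1024) (hr : RuleB m = false) (p : Fin 11 → R)
    (hp₁ : ∀ e : Fin 10, m.testBit e = true → 0 < p (Fin.castSucc e) ∧ p (Fin.castSucc e) < 1)
    (hp₀ : ∀ e : Fin 10, m.testBit e = false → p (Fin.castSucc e) = 0)
    (ht : 0 < p (Fin.last 10) ∧ p (Fin.last 10) < 1) :
    0 < Gc p Pendant.ends6 0 1 2 5 4 := by
  rw [gc6_quadratic]
  have h01 : ∀ e : Fin 10, 0 ≤ (p ∘ Fin.castSucc) e ∧ (p ∘ Fin.castSucc) e ≤ 1 := fun e => by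
    by_cases he : m.testBit e = true
    · exact ⟨(hp₁ e he).1.le, (hp₁ e he).2.le⟩
    · simp only [Function.comp_apply]
      rw [hp₀ e (by simpa using he)]
      exact ⟨le_rfl, zero_le_one⟩
  have hq : IsProbVec (p ∘ Fin.castSucc) := ⟨fun e => (h01 e).1, fun e => (h01 e).2⟩
  have hI : 0 ≤ ∑ k' : Fin 10 → Fin 4, bern (p ∘ Fin.castSucc) k' * (2 * Pendant.CI k') :=
    Finset.sum_nonneg fun k' _ =>
      mul_nonneg (bern_nonneg h01 k') (mul_nonneg zero_le_two (Pendant.CI_nonneg k'))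
  have hB := beta1_K5_pos_of_face m hm hr (p ∘ Fin.castSucc) hp₁ hp₀
  rw [beta1_eq_bern] at hB
  have hB' : 0 < ∑ k' : Fin 10 → Fin 4, bern (p ∘ Fin.castSucc) k' * (2 * Pendant.C k') := by
    have : ∑ k' : Fin 10 → Fin 4, bern (p ∘ Fin.castSucc) k' * (2 * Pendant.C k') =
        2 * ∑ k, bern (p ∘ Fin.castSucc) k * ((cntPosB k : ℕ) - (cntNegB k : ℕ) : R) := by
      rw [Finset.mul_sum]
      refine Finset.sum_congr rfl fun k _ => ?_
      unfold Pendant.C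
      ring
    rw [this]
    exact mul_pos two_pos hB
  have hG : 0 ≤ Gc (p ∘ Fin.castSucc) ends5 0 1 2 3 4 := HCov_K5 _ hq
  have ht1 : 0 < 1 - p (Fin.last 10) := sub_pos.2 ht.2
  have e1 : 0 ≤ (1 - p (Fin.last 10)) ^ 2 *
      (∑ k' : Fin 10 → Fin 4, bern (p ∘ Fin.castSucc) k' * (2 * Pendant.CI k')) :=
    mul_nonneg (pow_nonneg ht1.le 2) hI
  have e2 : 0 < p (Fin.last 10) * (1 - p (Fin.last 10)) *
      (∑ k' : Fin 10 → Fin 4, bern (p ∘ Fin.castSucc) k' * (2 * Pendant.C k')) :=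
    mul_pos (mul_pos ht.1 ht1) hB'
  have e3 : 0 ≤ p (Fin.last 10) ^ 2 * Gc (p ∘ Fin.castSucc) ends5 0 1 2 3 4 :=
    mul_nonneg (pow_nonneg ht.1.le 2) hG
  linarith

/-- The centre of the pendant face: `½` on the edges of `m` and on the pendant edge, `0` elsewhere. -/
noncomputable def centreP (m : ℕ) : Fin 11 → R := Fin.snoc (α := fun _ => R) (centre m) (1 / 2)

omit [LinearOrder R] [IsStrictOrderedRing R] in
/-- `centreP` on the `K₅` edges is the centre of `m`. -/
lemma centreP_castSucc (m : ℕ) (e : Fin 10) : centreP (R := R) m (Fin.castSucc e) = centre m e := by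
  unfold centreP; simp [Fin.snoc_castSucc]

omit [LinearOrder R] [IsStrictOrderedRing R] in
/-- The pendant weight of `centreP` is `½`. -/
lemma centreP_last (m : ℕ) : centreP (R := R) m (Fin.last 10) = 1 / 2 :=
  Fin.snoc_last _ _

/-- `0 < ½ < 1`. -/
lemma centreP_last_01 (m : ℕ) : 0 < centreP (R := R) m (Fin.last 10) ∧ centreP (R := R) m (Fin.last 10) < 1 := by
  rw [centreP_last]; exact ⟨one_half_pos, one_half_lt_one⟩

/-- **THEOREM 19, FIRST «IFF»**: on the six-vertex pendant family, `Gc > 0` at every weight vector interior on the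
pendant face of `m` ⟺ `m` is not `B`-degenerate. -/
theorem gc6_pos_iff (m : ℕ) (hm : m < 1024) :
    (∀ p : Fin 11 → R, (∀ e : Fin 10, m.testBit e = true → 0 < p (Fin.castSucc e) ∧ p (Fin.castSucc e) < 1) →
      (∀ e : Fin 10, m.testBit e = false → p (Fin.castSucc e) = 0) →
      (0 < p (Fin.last 10) ∧ p (Fin.last 10) < 1) → 0 < Gc p Pendant.ends6 0 1 2 5 4) ↔ RuleB m = false := by
  constructor
  · intro h
    rcases Bool.eq_false_or_eq_true (RuleB m) with hr | hr
    · exfalso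
      have hpos := h (centreP (R := R) m) (fun e he => by rw [centreP_castSucc]; exact centre_on_pos he)
        (fun e he => by rw [centreP_castSucc]; exact centre_off he) (centreP_last_01 m)
      have hzero := gc6_zero_of_face m hm hr (centreP (R := R) m)
        (fun e he => by rw [centreP_castSucc]; exact centre_off he)
      rw [hzero] at hpos
      exact lt_irrefl _ hpos
    · exact hr
  · intro hr p hp₁ hp₀ ht
    exact gc6_pos_of_face m hm hr p hp₁ hp₀ ht

/-- **THEOREM 19, SECOND «IFF»**: on the six-vertex pendant family, `Gc = 0` at every admissible weight vector whose
`K₅` weights are supported on `m` (the pendant weight free) ⟺ `m` is `B`-degenerate. -/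
theorem gc6_zero_iff (m : ℕ) (hm : m < 1024) :
    (∀ p : Fin 11 → R, (∀ e : Fin 11, 0 ≤ p e ∧ p e ≤ 1) →
      (∀ e : Fin 10, m.testBit e = false → p (Fin.castSucc e) = 0) →
      Gc p Pendant.ends6 0 1 2 5 4 = 0) ↔ RuleB m = true := by
  constructor
  · intro h
    rcases Bool.eq_false_or_eq_true (RuleB m) with hr | hr
    · exact hr
    · exfalso
      have hpos := gc6_pos_of_face m hm hr (centreP (R := R) m)
        (fun e he => by rw [centreP_castSucc]; exact centre_on_pos he)
        (fun e he => by rw [centreP_castSucc]; exact centre_off he) (centreP_last_01 m)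
      have h01 : ∀ e : Fin 11, 0 ≤ centreP (R := R) m e ∧ centreP (R := R) m e ≤ 1 := by
        intro e
        induction e using Fin.lastCases with
        | last => rw [centreP_last]; exact ⟨by norm_num, by norm_num⟩
        | cast e => rw [centreP_castSucc]; exact centre_01 m e
      have hzero := h (centreP (R := R) m) h01 (fun e he => by rw [centreP_castSucc]; exact centre_off he)
      rw [hzero] at hpos
      exact lt_irrefl _ hpos
  · intro hr p _ hp₀
    exact gc6_zero_of_face m hm hr p hp₀

/-! ## The glued face `t = 1` (Theorem 18 with `u` as the third mark) -/

omit [LinearOrder R] [IsStrictOrderedRing R] in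
/-- **The glued face**: with the pendant edge pinned open, `Gc` on `ends6` is Theorem 18's crux functional on the
`K₅` weights with `u = 3` as the third mark. -/
theorem gc_glued_eq (p : Fin 11 → R) :
    Gc (Function.update p (Fin.last 10) 1) Pendant.ends6 0 1 2 5 4 = Gc (p ∘ Fin.castSucc) ends5 0 1 2 3 4 := by
  rw [PMPendant.Gc_pendant_one (ends := Pendant.ends6) (a₃ := 5) (u := 3) (f := Fin.last 10)
    ends6_last' Pendant.leaf_five (by decide) p 0 1 2 4 (by decide) (by decide) (by decide) (by decide),
    Pendant.Gc_transfer, Pendant.update_comp_castSucc]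

/-- **THE GLUED FACE, «IFF»**: with the pendant edge pinned open, `Gc = 0` at every admissible weight vector whose
`K₅` weights are supported on `m` ⟺ `m` is `G`-degenerate (Theorem 18, `u` in the place of `a₃`). -/
theorem gc_glued_zero_iff (m : ℕ) (hm : m < 1024) :
    (∀ p : Fin 11 → R, (∀ e : Fin 11, 0 ≤ p e ∧ p e ≤ 1) →
      (∀ e : Fin 10, m.testBit e = false → p (Fin.castSucc e) = 0) →
      Gc (Function.update p (Fin.last 10) 1) Pendant.ends6 0 1 2 5 4 = 0) ↔ RuleG m = true := by
  rw [← gc_K5_zero_iff (R := R) m hm]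
  constructor
  · intro h q hq hq₀
    have := h (Fin.snoc (α := fun _ => R) q 1)
      (fun e => by
        induction e using Fin.lastCases with
        | last => simp only [Fin.snoc_last]; exact ⟨zero_le_one, le_rfl⟩
        | cast e => simp only [Fin.snoc_castSucc]; exact hq e)
      (fun e he => by simp only [Fin.snoc_castSucc]; exact hq₀ e he)
    rwa [gc_glued_eq, Pendant.snoc_comp_castSucc] at this
  · intro h p hp hp₀
    rw [gc_glued_eq]
    exact h (p ∘ Fin.castSucc) (fun e => hp _) hp₀

end Pendant

end PM

end K5

end Summit.Ventures.PercRepro2
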